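import Literature.Probability.Percolation.IsoradialArmComparison
import Literature.Probability.Percolation.IsoradialArmComparabilityProofs
import Literature.Probability.Percolation.RSW
import HarnessLib

/-!
# Alternating arm events on isoradial graphs (GM 2014, Prop. 8.1, `k = 2j ≥ 4`):
elementary supporting lemmas

Proofs-only companion of `Literature.Probability.Percolation.IsoradialArmComparison`, which
vendors Grimmett–Manolescu, *Bond percolation on isoradial graphs: criticality and
universality*, PTRF 159 (2014) 273–327 = arXiv:1204.0505, §8.1 Prop. (exp_transport) with §8.2
Prop. (exp_equiv), for the alternating events `k = 2j ≥ 4`, as the named fact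
`GrimmettManolescu2014_altArmComparability` (call it `T`), stated on the cluster-separated
alternating arm event `RhombicEmbedding.embAltArmEvent` of `IsoradialArmUniversality`. This
file consists of theorems only (D-0026: no new definition, no new named fact) and records what a
`provefact` seat on `T` (2026-08-15) could land; it parallels
`IsoradialArmComparabilityProofs` (the same lemmas for the vertex-disjoint events
`embArmEvent` behind the sibling fact `GrimmettManolescu2014_armComparability_one_two`).

## Status of the discharge

`T` is **not** discharged here. The printed proof (§8 of the arXiv text, pp. 23–27) is the
star–triangle transport of arm events: §8.2 Prop. (exp_equiv) ((a), (b): comparability under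
halving the outer / doubling the inner radius; (c): equivalence with the track-adapted events
`Ã_k`, "`x_i ↔ y_i` and `x_i ↮ x_{i'}` for `i ≠ i'`"), proved in §8.5 from the separation
theorem (Theorem (separation), whose "proof is omitted, and may be constructed via careful
readings of" Kesten 1987 and Nolin 2008), the box-crossing property and the extended Harris–FKG
inequality; §8.3 Lemma (exp_transport1) (isoradial square lattices, track exchanges `Σ_j` of
§5.3 composed into `U_m`, "clusters neither break nor merge") with Cor. (exp_transport1_cor);
§8.4 Lemma (general graphs of `𝒢(ε, I)`, grid sliding of §7 using clause (b) of SGP(I): "each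
`r_i` intersects each `s_j`"). Every step uses the main Theorem of §3 — §8.5.1: "By Theorem
(main), `P_G` satisfies BXP(δ) with `δ = δ(ε, I)`" — which in the tree is the *unproved* named
fact `gm_boxCrossingBounds_uniform`. The discharge of `T` is therefore blocked on that fact, and
beyond it on a theory (star–triangle transformations of rhombic tilings acting on open paths,
track systems, the separation theorem for isoradial graphs) absent from Mathlib and from
`Literature`.

## Contents (all proved)

* `annulusPts_mono`, `RhombicEmbedding.dualConnIn_mono` (with `Percolation.openConnIn_mono` of
  `RSW`): shrinking the annulus shrinks the connection events — the reason cluster *separation*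
  `x_i ↮ x_{i'}` survives the passage to a smaller annulus.
* `RhombicEmbedding.embAltArmEvent_inter_subset_outer`, `…_inner` and the probability forms
  `RhombicEmbedding.embAltArmProb_outer_anti`, `…_inner_mono`, `…_mono_annulus` — **the inclusion
  halves of Prop. (exp_equiv) (a), (b) for the alternating events in the tree's rendering**: for
  `r ≤ R' ≤ R`, `A_{2j}(r, R) ∩ {ω ⊆ E(G)} ⊆ A_{2j}(r, R')`, and for `r ≤ r' ≤ R`,
  `A_{2j}(r, R) ∩ {ω ⊆ E(G)} ⊆ A_{2j}(r', R)`; hence `P_G[A_{2j}(r, R)] ≤ P_G[A_{2j}(r, R')]` and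
  `P_G[A_{2j}(r, R)] ≤ P_G[A_{2j}(r', R)]` (GM §8.2, first inequalities of the displays (a)
  `P[A_k(N, 2n)] ≤ P[A_k(N, n)]` and (b) `P[A_k(N, n)] ≤ P[A_k(2N, n)]`; the reverse inequalities
  are the deep halves). Proof: each crossing `x_i ↔ y_i` inside the annulus is an open walk
  (`mem_openConnIn_iff_exists_openWalk`), cut at its first visit to `{R' ≤ ‖·‖_∞}` (resp.
  restarted at its last visit to `{‖·‖_∞ ≤ r'}`) by the sibling file's
  `IsoradialArmComparability.exists_walk_truncate`; the slack `2` absorbs the last (first) step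
  (primal and dual edges of an isoradial embedding are at most `2` long,
  `boxNorm_z_le_of_openGraph_adj`, `boxNorm_c_le_of_dualOpenGraph_adj`); separation of the new
  endpoints inside the smaller annulus follows from separation of the old ones inside the larger
  annulus, because the discarded pieces of the walks join old and new endpoints inside the larger
  annulus. Dual crossings likewise.
* `RhombicEmbedding.embAltArmProb_nonneg`, `…_le_one` — bookkeeping.

## References

* G. R. Grimmett, I. Manolescu, *Bond percolation on isoradial graphs: criticality and
  universality*, PTRF 159 (2014) 273–327, arXiv:1204.0505: §3 (arm events `A_σ(N, n)`), §8.1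
  Prop. (exp_transport), §8.2 Prop. (exp_equiv) (a), (b), §8.3–8.5 (proof structure; Theorem
  (separation), proof omitted there), §4.4 (edge lengths `< 2`).
* H. Kesten, *Scaling relations for 2D-percolation*, Comm. Math. Phys. 109 (1987) 109–156
  (separation theorem); P. Nolin, *Near-critical percolation in two dimensions*, EJP 13 (2008).
-/

noncomputable section

open MeasureTheory

namespace Literature.Probability.Percolation

open LatticeModels Percolation IsoradialArmComparability

/-! ### Monotonicity of the annulus and of the connection events in the ambient set -/

/-- A smaller annulus (larger inner radius, smaller outer radius) has fewer points.
[cite: GrimmettManolescu2014Isoradial, §3 (annulus A(N,n))] -/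
theorem annulusPts_mono {α : Type*} (z : α → ℂ) {r r' R' R : ℕ} (hr : r ≤ r') (hR : R' ≤ R) :
    annulusPts z r' R' ⊆ annulusPts z r R := by
  intro a ha
  rw [mem_annulusPts, Set.mem_Icc] at ha ⊢
  have hr' : (r : ℝ) ≤ r' := by exact_mod_cast hr
  have hR' : (R' : ℝ) ≤ R := by exact_mod_cast hR
  constructor <;> linarith [ha.1, ha.2]

section Conn

variable {V F : Type*} {G : SimpleGraph V} (emb : RhombicEmbedding G F)

/-- `{f ↔* g in S}` is monotone in `S` (dual analogue of `Percolation.openConnIn_mono`).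
[folklore] -/
theorem _root_.Literature.Probability.LatticeModels.RhombicEmbedding.dualConnIn_mono
    {S S' : Set F} (h : S ⊆ S') {ω : BondConfig V} {f g : F} (hfg : emb.dualConnIn ω S f g) :
    emb.dualConnIn ω S' f g := by
  obtain ⟨hf, hg, hr⟩ := hfg
  exact ⟨h hf, h hg, hr.map (SimpleGraph.induceHomOfLE (G := emb.dualOpenGraph ω) h).toHom⟩

/-- `{f ↔* g in S}` is symmetric. [folklore] -/
theorem _root_.Literature.Probability.LatticeModels.RhombicEmbedding.dualConnIn_symm
    {S : Set F} {ω : BondConfig V} {f g : F} (h : emb.dualConnIn ω S f g) :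
    emb.dualConnIn ω S g f := by
  obtain ⟨hf, hg, hr⟩ := h
  exact ⟨hg, hf, hr.symm⟩

/-- `{f ↔* g in S}` is transitive. [folklore] -/
theorem _root_.Literature.Probability.LatticeModels.RhombicEmbedding.dualConnIn_trans
    {S : Set F} {ω : BondConfig V} {f g k : F} (h : emb.dualConnIn ω S f g)
    (h' : emb.dualConnIn ω S g k) : emb.dualConnIn ω S f k := by
  obtain ⟨hf, hg, hr⟩ := h
  obtain ⟨hg', hk, hr'⟩ := h'
  exact ⟨hf, hk, hr.trans hr'⟩

/-- A vertex on an open walk supported in `S` is joined to the start of the walk inside `S`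
(`Walk.takeUntil`; variant of `mem_openConnIn_of_mem_support` of `PlanarDuality` for walks of
the open graph itself). [folklore] -/
theorem mem_openConnIn_of_mem_support_openWalk {S : Set V} {ω : BondConfig V} {x y u : V}
    (w : (openGraph ω).Walk x y) (hw : ∀ v ∈ w.support, v ∈ S) (hu : u ∈ w.support) :
    ω ∈ openConnIn S x u := by
  classical
  exact mem_openConnIn_iff_exists_openWalk.2
    ⟨w.takeUntil u hu, fun v hv => hw v (w.support_takeUntil_subset_support hu hv)⟩

/-- Dual analogue of `mem_openConnIn_of_mem_support_openWalk`. [folklore] -/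
theorem _root_.Literature.Probability.LatticeModels.RhombicEmbedding.dualConnIn_of_mem_support
    {S : Set F} {ω : BondConfig V} {f g k : F} (w : (emb.dualOpenGraph ω).Walk f g)
    (hw : ∀ v ∈ w.support, v ∈ S) (hk : k ∈ w.support) : emb.dualConnIn ω S f k := by
  classical
  exact (emb.dualConnIn_iff_exists_walk ω S f k).2
    ⟨w.takeUntil k hk, fun v hv => hw v (w.support_takeUntil_subset_support hk hv)⟩

end Conn

/-! ### Monotonicity of the alternating arm events in the radii (GM §8.2, (a)–(b), inclusion halves) -/

section Monotone

variable {V F : Type*} {G : SimpleGraph V} (emb : RhombicEmbedding G F)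

/-- **Shrinking the outer radius enlarges the alternating arm event** (up to configurations
using non-edges of `G`): for `r ≤ R' ≤ R`, `A_{2j}(r, R) ∩ {ω ⊆ E(G)} ⊆ A_{2j}(r, R')` for the
cluster-separated events `embAltArmEvent`. Each crossing `x_i ↔ y_i` inside the annulus
`{r - 2 ≤ ‖·‖_∞ ≤ R + 2}` is cut at its first vertex of sup norm `≥ R'`, which has sup norm
`≤ R' + 2` (one open step moves the sup norm by at most `2`); the `x_i` are unchanged, and
`x_i ↮ x_{i'}` inside the smaller annulus because connection events are monotone in the ambient
set. Dual crossings likewise. This is the inclusion `A_k(N, 2n) ⊆ A_k(N, n)` behind the first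
inequality of Grimmett–Manolescu's Prop. (exp_equiv) (a), for `k = 2j`, in the slack-`2`
rendering. [cite: GrimmettManolescu2014Isoradial, §8.2 Prop. (exp_equiv) (a), first inequality] -/
theorem _root_.Literature.Probability.LatticeModels.RhombicEmbedding.embAltArmEvent_inter_subset_outer
    (hiso : emb.IsIsoradial) (j : ℕ) {r R' R : ℕ} (hrR' : r ≤ R') (hR'R : R' ≤ R) :
    emb.embAltArmEvent j r R ∩ {ω | ω ⊆ G.edgeSet} ⊆ emb.embAltArmEvent j r R' := by
  rintro ω ⟨⟨⟨x, y, hxy, hsep⟩, ⟨f, g, hfg, hsep'⟩⟩, hgood⟩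
  have hgood' : ω ⊆ G.edgeSet := hgood
  have hrR'ℝ : (r : ℝ) ≤ R' := by exact_mod_cast hrR'
  have hR'Rℝ : (R' : ℝ) ≤ R := by exact_mod_cast hR'R
  have hsub : annulusPts emb.z r R' ⊆ annulusPts emb.z r R := annulusPts_mono emb.z le_rfl hR'R
  have hsubc : annulusPts emb.c r R' ⊆ annulusPts emb.c r R := annulusPts_mono emb.c le_rfl hR'R
  refine ⟨?_, ?_⟩
  · -- primal crossings, cut at the first visit to `{R' ≤ ‖·‖_∞}`
    have key : ∀ i, ∃ y' : V, (R' : ℝ) ≤ (emb.z y').boxNorm ∧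
        ω ∈ openConnIn (annulusPts emb.z r R') (x i) y' := by
      intro i
      obtain ⟨hx, hy, hconn⟩ := hxy i
      obtain ⟨w, hw⟩ := mem_openConnIn_iff_exists_openWalk.1 hconn
      obtain ⟨y', q, h1, h2, h3⟩ := exists_walk_truncate (fun v => (emb.z v).boxNorm) (R' : ℝ)
        (fun a b hab => emb.boxNorm_z_le_of_openGraph_adj hiso hgood' hab) w
        (by linarith) (hR'Rℝ.trans hy)
      refine ⟨y', h1, mem_openConnIn_iff_exists_openWalk.2 ⟨q, fun v hv => ?_⟩⟩
      have hvw := hw v (h2 v hv)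
      rw [mem_annulusPts, Set.mem_Icc] at hvw ⊢
      exact ⟨hvw.1, h3 v hv⟩
    choose y' hy'R hy'conn using key
    exact ⟨x, y', fun i => ⟨(hxy i).1, hy'R i, hy'conn i⟩,
      fun i i' hii' hc => hsep hii' (openConnIn_mono hsub _ _ hc)⟩
  · -- dual crossings, likewise
    have key : ∀ i, ∃ g' : F, (R' : ℝ) ≤ (emb.c g').boxNorm ∧
        emb.dualConnIn ω (annulusPts emb.c r R') (f i) g' := by
      intro i
      obtain ⟨hf, hg, hconn⟩ := hfg i
      obtain ⟨w, hw⟩ := (emb.dualConnIn_iff_exists_walk ω _ _ _).1 hconn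
      obtain ⟨g', q, h1, h2, h3⟩ := exists_walk_truncate (fun v => (emb.c v).boxNorm) (R' : ℝ)
        (fun a b hab => emb.boxNorm_c_le_of_dualOpenGraph_adj hiso hab) w
        (by linarith) (hR'Rℝ.trans hg)
      refine ⟨g', h1, (emb.dualConnIn_iff_exists_walk ω _ _ _).2 ⟨q, fun v hv => ?_⟩⟩
      have hvw := hw v (h2 v hv)
      rw [mem_annulusPts, Set.mem_Icc] at hvw ⊢
      exact ⟨hvw.1, h3 v hv⟩
    choose g' hg'R hg'conn using key
    exact ⟨f, g', fun i => ⟨(hfg i).1, hg'R i, hg'conn i⟩,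
      fun i i' hii' hc => hsep' hii' (emb.dualConnIn_mono hsubc hc)⟩

/-- **Enlarging the inner radius enlarges the alternating arm event** (up to configurations
using non-edges of `G`): for `r ≤ r' ≤ R`, `A_{2j}(r, R) ∩ {ω ⊆ E(G)} ⊆ A_{2j}(r', R)`. Each
crossing `x_i ↔ y_i` is restarted at its last vertex `x_i'` of sup norm `≤ r'` (first-visit
truncation of the reversed walk for the height `-‖·‖_∞`), which has sup norm `≥ r' - 2`. The
new starting points are separated inside the smaller annulus: an open path of the smaller
annulus from `x_i'` to `x_{i'}'`, together with the discarded initial pieces `x_i ↔ x_i'`,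
`x_{i'} ↔ x_{i'}'` of the old crossings (inside the larger annulus), would join `x_i` to
`x_{i'}` inside the larger annulus. Dual crossings likewise. This is the inclusion
`A_k(N, n) ⊆ A_k(2N, n)` behind the first inequality of Grimmett–Manolescu's Prop. (exp_equiv)
(b), for `k = 2j`, in the slack-`2` rendering.
[cite: GrimmettManolescu2014Isoradial, §8.2 Prop. (exp_equiv) (b), first inequality] -/
theorem _root_.Literature.Probability.LatticeModels.RhombicEmbedding.embAltArmEvent_inter_subset_inner
    (hiso : emb.IsIsoradial) (j : ℕ) {r r' R : ℕ} (hrr' : r ≤ r') (hr'R : r' ≤ R) :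
    emb.embAltArmEvent j r R ∩ {ω | ω ⊆ G.edgeSet} ⊆ emb.embAltArmEvent j r' R := by
  rintro ω ⟨⟨⟨x, y, hxy, hsep⟩, ⟨f, g, hfg, hsep'⟩⟩, hgood⟩
  have hgood' : ω ⊆ G.edgeSet := hgood
  have hrr'ℝ : (r : ℝ) ≤ r' := by exact_mod_cast hrr'
  have hr'Rℝ : (r' : ℝ) ≤ R := by exact_mod_cast hr'R
  have hsub : annulusPts emb.z r' R ⊆ annulusPts emb.z r R := annulusPts_mono emb.z hrr' le_rfl
  have hsubc : annulusPts emb.c r' R ⊆ annulusPts emb.c r R := annulusPts_mono emb.c hrr' le_rfl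
  refine ⟨?_, ?_⟩
  · -- primal crossings, restarted at the last visit to `{‖·‖_∞ ≤ r'}`
    have key : ∀ i, ∃ x' : V, (emb.z x').boxNorm ≤ r' ∧
        ω ∈ openConnIn (annulusPts emb.z r' R) x' (y i) ∧
        ω ∈ openConnIn (annulusPts emb.z r R) (x i) x' := by
      intro i
      obtain ⟨hx, hy, hconn⟩ := hxy i
      obtain ⟨w, hw⟩ := mem_openConnIn_iff_exists_openWalk.1 hconn
      obtain ⟨x', q, h1, h2, h3⟩ := exists_walk_truncate (fun v => -(emb.z v).boxNorm)
        (-(r' : ℝ))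
        (fun a b hab => by
          have := emb.boxNorm_z_le_of_openGraph_adj hiso hgood' hab.symm
          linarith) w.reverse (by linarith) (by linarith)
      have hx'w : x' ∈ w.support := by
        have := h2 x' q.end_mem_support
        rwa [SimpleGraph.Walk.support_reverse, List.mem_reverse] at this
      refine ⟨x', by linarith, mem_openConnIn_iff_exists_openWalk.2
        ⟨q.reverse, fun v hv => ?_⟩, mem_openConnIn_of_mem_support_openWalk w hw hx'w⟩
      rw [SimpleGraph.Walk.support_reverse, List.mem_reverse] at hv
      have hvw : v ∈ w.support := by
        have := h2 v hv
        rwa [SimpleGraph.Walk.support_reverse, List.mem_reverse] at this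
      have hvw' := hw v hvw
      have h3v := h3 v hv
      rw [mem_annulusPts, Set.mem_Icc] at hvw' ⊢
      exact ⟨by linarith, hvw'.2⟩
    choose x' hx'r hx'conn hxx' using key
    refine ⟨x', y, fun i => ⟨hx'r i, (hxy i).2.1, hx'conn i⟩, fun i i' hii' hc => hsep hii' ?_⟩
    -- `x_i ↔ x_i' ↔ x_{i'}' ↔ x_{i'}` inside the larger annulus
    exact PlanarDuality.openConnIn_trans
      (PlanarDuality.openConnIn_trans (hxx' i) (openConnIn_mono hsub _ _ hc))
      ((openConnIn_comm _ _ _).subset (hxx' i'))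
  · -- dual crossings, likewise
    have key : ∀ i, ∃ f' : F, (emb.c f').boxNorm ≤ r' ∧
        emb.dualConnIn ω (annulusPts emb.c r' R) f' (g i) ∧
        emb.dualConnIn ω (annulusPts emb.c r R) (f i) f' := by
      intro i
      obtain ⟨hf, hg, hconn⟩ := hfg i
      obtain ⟨w, hw⟩ := (emb.dualConnIn_iff_exists_walk ω _ _ _).1 hconn
      obtain ⟨f', q, h1, h2, h3⟩ := exists_walk_truncate (fun v => -(emb.c v).boxNorm)
        (-(r' : ℝ))
        (fun a b hab => by
          have := emb.boxNorm_c_le_of_dualOpenGraph_adj hiso hab.symm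
          linarith) w.reverse (by linarith) (by linarith)
      have hf'w : f' ∈ w.support := by
        have := h2 f' q.end_mem_support
        rwa [SimpleGraph.Walk.support_reverse, List.mem_reverse] at this
      refine ⟨f', by linarith, (emb.dualConnIn_iff_exists_walk ω _ _ _).2
        ⟨q.reverse, fun v hv => ?_⟩, emb.dualConnIn_of_mem_support w hw hf'w⟩
      rw [SimpleGraph.Walk.support_reverse, List.mem_reverse] at hv
      have hvw : v ∈ w.support := by
        have := h2 v hv
        rwa [SimpleGraph.Walk.support_reverse, List.mem_reverse] at this
      have hvw' := hw v hvw
      have h3v := h3 v hv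
      rw [mem_annulusPts, Set.mem_Icc] at hvw' ⊢
      exact ⟨by linarith, hvw'.2⟩
    choose f' hf'r hf'conn hff' using key
    refine ⟨f', g, fun i => ⟨hf'r i, (hfg i).2.1, hf'conn i⟩, fun i i' hii' hc => hsep' hii' ?_⟩
    exact emb.dualConnIn_trans (emb.dualConnIn_trans (hff' i) (emb.dualConnIn_mono hsubc hc))
      (emb.dualConnIn_symm (hff' i'))

/-- **Alternating arm probabilities are nonnegative.** [folklore] -/
theorem _root_.Literature.Probability.LatticeModels.RhombicEmbedding.embAltArmProb_nonneg
    (j r R : ℕ) : 0 ≤ emb.isoradialPercolation.real (emb.embAltArmEvent j r R) :=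
  measureReal_nonneg

/-- **Alternating arm probabilities are at most `1`.** [folklore] -/
theorem _root_.Literature.Probability.LatticeModels.RhombicEmbedding.embAltArmProb_le_one
    (j r R : ℕ) : emb.isoradialPercolation.real (emb.embAltArmEvent j r R) ≤ 1 :=
  measureReal_le_one

/-- **`P_G[A_{2j}(r, R)]` is antitone in the outer radius**: for `r ≤ R' ≤ R`,
`P_G[A_{2j}(r, R)] ≤ P_G[A_{2j}(r, R')]` — the first inequality of Grimmett–Manolescu's
Prop. (exp_equiv) (a), `P[A_k(N, 2n)] ≤ P[A_k(N, n)]`, for the alternating events of the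
tree. [cite: GrimmettManolescu2014Isoradial, §8.2 Prop. (exp_equiv) (a), first inequality] -/
theorem _root_.Literature.Probability.LatticeModels.RhombicEmbedding.embAltArmProb_outer_anti
    [Countable V] (hiso : emb.IsIsoradial) (j : ℕ) {r R' R : ℕ} (hrR' : r ≤ R')
    (hR'R : R' ≤ R) :
    emb.isoradialPercolation.real (emb.embAltArmEvent j r R) ≤
      emb.isoradialPercolation.real (emb.embAltArmEvent j r R') :=
  emb.real_le_real_of_inter_subset (emb.embAltArmEvent_inter_subset_outer hiso j hrR' hR'R)

/-- **`P_G[A_{2j}(r, R)]` is monotone in the inner radius**: for `r ≤ r' ≤ R`,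
`P_G[A_{2j}(r, R)] ≤ P_G[A_{2j}(r', R)]` — the first inequality of Grimmett–Manolescu's
Prop. (exp_equiv) (b), `P[A_k(N, n)] ≤ P[A_k(2N, n)]`, for the alternating events of the
tree. [cite: GrimmettManolescu2014Isoradial, §8.2 Prop. (exp_equiv) (b), first inequality] -/
theorem _root_.Literature.Probability.LatticeModels.RhombicEmbedding.embAltArmProb_inner_mono
    [Countable V] (hiso : emb.IsIsoradial) (j : ℕ) {r r' R : ℕ} (hrr' : r ≤ r')
    (hr'R : r' ≤ R) :
    emb.isoradialPercolation.real (emb.embAltArmEvent j r R) ≤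
      emb.isoradialPercolation.real (emb.embAltArmEvent j r' R) :=
  emb.real_le_real_of_inter_subset (emb.embAltArmEvent_inter_subset_inner hiso j hrr' hr'R)

/-- **Shrinking the annulus from both sides increases the alternating arm probability**: for
`r ≤ r' ≤ R' ≤ R`, `P_G[A_{2j}(r, R)] ≤ P_G[A_{2j}(r', R')]` (the two monotonicities combined;
the form in which the inclusion halves of Prop. (exp_equiv) (a), (b) are iterated in
§8.3–8.4). [cite: GrimmettManolescu2014Isoradial, §8.2 Prop. (exp_equiv) (a)–(b), first inequalities] -/
theorem _root_.Literature.Probability.LatticeModels.RhombicEmbedding.embAltArmProb_mono_annulus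
    [Countable V] (hiso : emb.IsIsoradial) (j : ℕ) {r r' R' R : ℕ} (hrr' : r ≤ r')
    (hr'R' : r' ≤ R') (hR'R : R' ≤ R) :
    emb.isoradialPercolation.real (emb.embAltArmEvent j r R) ≤
      emb.isoradialPercolation.real (emb.embAltArmEvent j r' R') :=
  (emb.embAltArmProb_outer_anti hiso j (hrr'.trans hr'R') hR'R).trans
    (emb.embAltArmProb_inner_mono hiso j hrr' hr'R')

end Monotone

end Literature.Probability.Percolation

end
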